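import Literature.NumberTheory.LFunctions.Zhang2022.Section8Lemma84Bookkeeping
import HarnessLib

/-!
# Zhang (2022) §12: the log-free twisted sum of the middle range — bookkeeping of the contour
# pieces (`Lemma84.rhs_logfree_le`)

Topic `Literature/NumberTheory/LFunctions/Zhang2022` (Landau–Siegel audit tree; verdict-neutral).
Y. Zhang, *Discrete mean estimates and the Landau–Siegel zero*, arXiv:2211.02515v1 (2022)
[Zhang2022LandauSiegel] — **an unrefereed manuscript under adjudication; nothing here asserts or
denies its Theorems 1–2, and no claim about Landau–Siegel zeros is made.** Lane ZHANG-L (strike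
seat zl-closer-3), leaf `Typed.Sec12C.Mid1225 c′` via the log-free sum LF of
`Typed.Sec12C.mid1225_of_logfree` (§12 p.71; (12.11) p.70, no proof in print, tex L3549).

Pure real-number bookkeeping (the twin of `Lemma84.rhs_le` for the difference-quotient contour of
`Lemma84.logfree_core`): with `𝓛 ≥ 3`, `α = π𝓛⁻⁹`, `η = c/(8𝓛)`, `T = D = e^{𝓛}`, `B_L = 2(4+3𝓛)`,
`M_inv = 3C_inv𝓛`, `M_U ≤ A₁𝓛^m`, `L = log Y ≤ 𝓛⁹`, `L′ = log Y′ ≥ 0.004𝓛⁹ − 1`, and the step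
`h = 𝓛⁻⁵⁰`, the four pieces of `logfree_core` DIVIDED BY `h` are at most `C·𝓛⁻⁴·Π̂⁴`:
tails `𝓛^{m+81}e^{−𝓛} ≤ (m+81)!`; left side `e^{−ηL′} ≤ e^{1/96}e^{−(c/2000)𝓛⁸}` and
`(𝓛⁸)^{m+59}e^{−(c/2000)𝓛⁸} ≤ (m+59)!/(c/2000)^{m+59}`; horizontal sides `𝓛^{m+57}e^{−2𝓛} ≤ (m+57)!/2^{m+57}`;
small rectangle (where `h` cancels) `672e^{αL/2}(Δ + 2e^{9/2}(1+𝓛)𝓛Π̂²·2K²α) ≤ 672e^π(…)Π̂⁴𝓛⁻⁷`.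
Theorems only; no definitions; standard axioms.

## References

* Y. Zhang, arXiv:2211.02515v1 (2022), §12 (12.11) p.70; §8 Lemma 8.4 (proof).
  [cite: Zhang2022LandauSiegel, §12 (12.11) p.70; §8 Lemma 8.4]
-/

noncomputable section

open Real

namespace Literature.NumberTheory.LFunctions.Zhang2022.Lemma84

/-- `v^N e^{−av⁸·} bookkeeping`: for `𝓛 ≥ 1`, `a > 0`: `𝓛^N · e^{−a𝓛⁸} ≤ N!/a^N`
(`𝓛^N ≤ (𝓛⁸)^N` and `v^N e^{−av} ≤ N!/a^N`). [folklore] -/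
private theorem pow_mul_exp_neg_pow8_le {𝓛 a : ℝ} (h𝓛 : 1 ≤ 𝓛) (ha : 0 < a) (N : ℕ) :
    𝓛 ^ N * Real.exp (-(a * 𝓛 ^ 8)) ≤ (N.factorial : ℝ) / a ^ N := by
  have h8 : 𝓛 ≤ 𝓛 ^ 8 := le_self_pow₀ h𝓛 (by norm_num)
  have h0 : 0 ≤ 𝓛 := by linarith
  calc 𝓛 ^ N * Real.exp (-(a * 𝓛 ^ 8)) ≤ (𝓛 ^ 8) ^ N * Real.exp (-(a * 𝓛 ^ 8)) := by
        gcongr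
    _ ≤ (N.factorial : ℝ) / a ^ N := pow_mul_exp_neg_le ha (by positivity) N


section Pieces

variable {𝓛 Ly Ly' c Cinv C K A₁ hatPi MU : ℝ} {m : ℕ}

set_option maxHeartbeats 800000 in
/-- Piece 1 (tails): `𝓛⁵⁰·4e^{αL}M_U((1+α)/α)³/e^{𝓛} ≤ 4e^πA₁(m+81)!·𝓛⁻⁴`.
[cite: Zhang2022LandauSiegel, §8 Lemma 8.4 (proof)] -/
private theorem piece1 (h𝓛 : 3 ≤ 𝓛) (hA₁ : 0 ≤ A₁) (hMU0 : 0 ≤ MU) (hMU : MU ≤ A₁ * 𝓛 ^ m)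
    (hLy2 : Ly ≤ 𝓛 ^ 9) :
    𝓛 ^ 50 * (4 * (Real.exp (π / 𝓛 ^ 9 * Ly) *
      (MU * ((1 + π / 𝓛 ^ 9) / (π / 𝓛 ^ 9)) ^ 3) / Real.exp 𝓛)) ≤
      4 * Real.exp π * A₁ * (m + 81).factorial * (𝓛 ^ 4)⁻¹ := by
  have h𝓛0 : 0 < 𝓛 := by linarith
  have hπ0 := Real.pi_pos
  have hπ3 := Real.pi_gt_three
  have hL93 : (3 : ℝ) ^ 9 ≤ 𝓛 ^ 9 := pow_le_pow_left₀ (by norm_num) h𝓛 9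
  have hα0 : 0 < π / 𝓛 ^ 9 := by positivity
  have hαLy : π / 𝓛 ^ 9 * Ly ≤ π := by
    calc π / 𝓛 ^ 9 * Ly ≤ π / 𝓛 ^ 9 * 𝓛 ^ 9 := by gcongr
      _ = π := by field_simp
  have hexp1 : Real.exp (π / 𝓛 ^ 9 * Ly) ≤ Real.exp π := Real.exp_le_exp.2 hαLy
  have hinvα : (1 + π / 𝓛 ^ 9) / (π / 𝓛 ^ 9) ≤ 𝓛 ^ 9 := by
    rw [div_le_iff₀ hα0, show 𝓛 ^ 9 * (π / 𝓛 ^ 9) = π by field_simp]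
    have : π / 𝓛 ^ 9 ≤ π / 3 ^ 9 := by gcongr
    nlinarith
  have hinvα0 : 0 ≤ (1 + π / 𝓛 ^ 9) / (π / 𝓛 ^ 9) := by positivity
  have h1 : Real.exp (π / 𝓛 ^ 9 * Ly) * (MU * ((1 + π / 𝓛 ^ 9) / (π / 𝓛 ^ 9)) ^ 3) ≤
      Real.exp π * (A₁ * 𝓛 ^ m * (𝓛 ^ 9) ^ 3) := by gcongr
  have h2 : 𝓛 ^ 50 * (𝓛 ^ m * (𝓛 ^ 9) ^ 3) / Real.exp 𝓛 ≤ (m + 81).factorial * (𝓛 ^ 4)⁻¹ := by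
    have h := pow_mul_exp_neg_le (a := 1) one_pos h𝓛0.le (m + 81)
    rw [one_pow, div_one, one_mul] at h
    have e : 𝓛 ^ 50 * (𝓛 ^ m * (𝓛 ^ 9) ^ 3) / Real.exp 𝓛 =
        𝓛 ^ (m + 81) * Real.exp (-𝓛) * (𝓛 ^ 4)⁻¹ := by
      rw [Real.exp_neg]; field_simp; ring
    rw [e]
    exact mul_le_mul_of_nonneg_right h (by positivity)
  calc 𝓛 ^ 50 * (4 * (Real.exp (π / 𝓛 ^ 9 * Ly) *
        (MU * ((1 + π / 𝓛 ^ 9) / (π / 𝓛 ^ 9)) ^ 3) / Real.exp 𝓛))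
      ≤ 𝓛 ^ 50 * (4 * (Real.exp π * (A₁ * 𝓛 ^ m * (𝓛 ^ 9) ^ 3) / Real.exp 𝓛)) := by gcongr
    _ = 4 * Real.exp π * A₁ * (𝓛 ^ 50 * (𝓛 ^ m * (𝓛 ^ 9) ^ 3) / Real.exp 𝓛) := by ring
    _ ≤ 4 * Real.exp π * A₁ * ((m + 81).factorial * (𝓛 ^ 4)⁻¹) := by gcongr
    _ = _ := by ring

set_option maxHeartbeats 800000 in
/-- Piece 2 (left side): `𝓛⁵⁰·2e^{−ηL′}M_UB_L²M_inv(1+2/η)(π/η) ≤ 81600πe^{1/96}A₁C_inv/c²·(m+59)!/(c/2000)^{m+59}·𝓛⁻⁴`.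
[cite: Zhang2022LandauSiegel, §8 Lemma 8.4 (proof)] -/
private theorem piece2 (h𝓛 : 3 ≤ 𝓛) (hc : 0 < c) (hc1 : c ≤ 1 / 4) (hCinv : 0 ≤ Cinv)
    (hA₁ : 0 ≤ A₁) (hMU : MU ≤ A₁ * 𝓛 ^ m)
    (hLy'1 : 0.004 * 𝓛 ^ 9 - 1 ≤ Ly') :
    𝓛 ^ 50 * (2 * (Real.exp (-(c / (8 * 𝓛)) * Ly') *
      (MU * (2 * (4 + 3 * 𝓛)) * (2 * (4 + 3 * 𝓛)) * (3 * Cinv * 𝓛 * (1 + 2 / (c / (8 * 𝓛))))) *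
        (π / (c / (8 * 𝓛))))) ≤
      81600 * π * Real.exp (1 / 96) * A₁ * Cinv / c ^ 2 *
        ((m + 59).factorial / (c / 2000) ^ (m + 59)) * (𝓛 ^ 4)⁻¹ := by
  have h𝓛0 : 0 < 𝓛 := by linarith
  have h𝓛1 : 1 ≤ 𝓛 := by linarith
  have hπ0 := Real.pi_pos
  have hη0 : 0 < c / (8 * 𝓛) := by positivity
  have hBL : 2 * (4 + 3 * 𝓛) ≤ 10 * 𝓛 := by linarith
  have hBL0 : 0 ≤ 2 * (4 + 3 * 𝓛) := by positivity
  have h2η : 1 + 2 / (c / (8 * 𝓛)) ≤ 17 * 𝓛 / c := by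
    rw [div_div_eq_mul_div, show 1 + 2 * (8 * 𝓛) / c = (c + 16 * 𝓛) / c by field_simp; ring]
    gcongr
    linarith
  have hπη : π / (c / (8 * 𝓛)) = 8 * π * 𝓛 / c := by rw [div_div_eq_mul_div]; ring
  have hexpη : Real.exp (-(c / (8 * 𝓛)) * Ly') ≤
      Real.exp (1 / 96) * Real.exp (-(c / 2000 * 𝓛 ^ 8)) := by
    rw [← Real.exp_add, Real.exp_le_exp]
    have h1 : c / (8 * 𝓛) * (0.004 * 𝓛 ^ 9 - 1) ≤ c / (8 * 𝓛) * Ly' :=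
      mul_le_mul_of_nonneg_left hLy'1 hη0.le
    have e : c / (8 * 𝓛) * (0.004 * 𝓛 ^ 9 - 1) = c / 2000 * 𝓛 ^ 8 - c / (8 * 𝓛) := by
      field_simp; ring
    have h2 : c / (8 * 𝓛) ≤ 1 / 96 := by
      calc c / (8 * 𝓛) ≤ (1 / 4) / (8 * 3) := by gcongr
        _ = 1 / 96 := by norm_num
    rw [e] at h1
    linarith
  have hprod : MU * (2 * (4 + 3 * 𝓛)) * (2 * (4 + 3 * 𝓛)) *
      (3 * Cinv * 𝓛 * (1 + 2 / (c / (8 * 𝓛)))) * (π / (c / (8 * 𝓛))) ≤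
      (A₁ * 𝓛 ^ m) * (10 * 𝓛) * (10 * 𝓛) * (3 * Cinv * 𝓛 * (17 * 𝓛 / c)) * (8 * π * 𝓛 / c) := by
    rw [hπη]
    gcongr
  have hdec : 𝓛 ^ (m + 59) * Real.exp (-(c / 2000 * 𝓛 ^ 8)) ≤
      ((m + 59).factorial : ℝ) / (c / 2000) ^ (m + 59) :=
    pow_mul_exp_neg_pow8_le h𝓛1 (by positivity) (m + 59)
  have eprod : (A₁ * 𝓛 ^ m) * (10 * 𝓛) * (10 * 𝓛) * (3 * Cinv * 𝓛 * (17 * 𝓛 / c)) *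
      (8 * π * 𝓛 / c) = (40800 * π * A₁ * Cinv / c ^ 2) * (𝓛 ^ m * 𝓛 ^ 5) := by
    field_simp; ring
  have e55 : 𝓛 ^ 50 * (𝓛 ^ m * 𝓛 ^ 5) = 𝓛 ^ (m + 59) * (𝓛 ^ 4)⁻¹ := by
    rw [pow_add]; field_simp
  have hA𝓛 : 0 ≤ A₁ * 𝓛 ^ m := mul_nonneg hA₁ (pow_nonneg h𝓛0.le m)
  have h10 : (0 : ℝ) ≤ 10 * 𝓛 := by linarith
  have h17 : 0 ≤ 3 * Cinv * 𝓛 * (17 * 𝓛 / c) :=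
    mul_nonneg (mul_nonneg (mul_nonneg (by norm_num) hCinv) h𝓛0.le)
      (div_nonneg (by linarith) hc.le)
  have h8 : 0 ≤ 8 * π * 𝓛 / c := div_nonneg (by positivity) hc.le
  have hP0 : 0 ≤ (A₁ * 𝓛 ^ m) * (10 * 𝓛) * (10 * 𝓛) * (3 * Cinv * 𝓛 * (17 * 𝓛 / c)) *
      (8 * π * 𝓛 / c) := mul_nonneg (mul_nonneg (mul_nonneg (mul_nonneg hA𝓛 h10) h10) h17) h8
  have h502 : (0 : ℝ) ≤ 𝓛 ^ 50 * 2 := by positivity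
  calc 𝓛 ^ 50 * (2 * (Real.exp (-(c / (8 * 𝓛)) * Ly') *
        (MU * (2 * (4 + 3 * 𝓛)) * (2 * (4 + 3 * 𝓛)) * (3 * Cinv * 𝓛 * (1 + 2 / (c / (8 * 𝓛))))) *
        (π / (c / (8 * 𝓛)))))
      = 𝓛 ^ 50 * 2 * (Real.exp (-(c / (8 * 𝓛)) * Ly') *
        ((MU * (2 * (4 + 3 * 𝓛)) * (2 * (4 + 3 * 𝓛)) * (3 * Cinv * 𝓛 * (1 + 2 / (c / (8 * 𝓛))))) *
        (π / (c / (8 * 𝓛))))) := by ring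
    _ ≤ 𝓛 ^ 50 * 2 * (Real.exp (-(c / (8 * 𝓛)) * Ly') *
        ((A₁ * 𝓛 ^ m) * (10 * 𝓛) * (10 * 𝓛) * (3 * Cinv * 𝓛 * (17 * 𝓛 / c)) * (8 * π * 𝓛 / c))) :=
        mul_le_mul_of_nonneg_left (mul_le_mul_of_nonneg_left hprod (Real.exp_pos _).le) h502
    _ ≤ 𝓛 ^ 50 * 2 * ((Real.exp (1 / 96) * Real.exp (-(c / 2000 * 𝓛 ^ 8))) *
        ((A₁ * 𝓛 ^ m) * (10 * 𝓛) * (10 * 𝓛) * (3 * Cinv * 𝓛 * (17 * 𝓛 / c)) * (8 * π * 𝓛 / c))) :=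
        mul_le_mul_of_nonneg_left (mul_le_mul_of_nonneg_right hexpη hP0) h502
    _ = (2 * Real.exp (1 / 96) * (40800 * π * A₁ * Cinv / c ^ 2)) * (𝓛 ^ 50 * (𝓛 ^ m * 𝓛 ^ 5)) *
        Real.exp (-(c / 2000 * 𝓛 ^ 8)) := by rw [eprod]; ring
    _ = 81600 * π * Real.exp (1 / 96) * A₁ * Cinv / c ^ 2 *
        (𝓛 ^ (m + 59) * Real.exp (-(c / 2000 * 𝓛 ^ 8))) * (𝓛 ^ 4)⁻¹ := by
        rw [e55]; ring
    _ ≤ 81600 * π * Real.exp (1 / 96) * A₁ * Cinv / c ^ 2 *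
        (((m + 59).factorial : ℝ) / (c / 2000) ^ (m + 59)) * (𝓛 ^ 4)⁻¹ := by gcongr

set_option maxHeartbeats 800000 in
/-- Piece 3 (horizontal sides): `𝓛⁵⁰·4(α+η)e^{αL}M_UB_L²3M_inv/e^{2𝓛} ≤ 3600e^πA₁C_inv(m+57)!/2^{m+57}·𝓛⁻⁴`.
[cite: Zhang2022LandauSiegel, §8 Lemma 8.4 (proof)] -/
private theorem piece3 (h𝓛 : 3 ≤ 𝓛) (hc : 0 < c) (hc1 : c ≤ 1 / 4) (hCinv : 0 ≤ Cinv)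
    (hA₁ : 0 ≤ A₁) (hMU0 : 0 ≤ MU) (hMU : MU ≤ A₁ * 𝓛 ^ m) (hLy2 : Ly ≤ 𝓛 ^ 9) :
    𝓛 ^ 50 * (4 * ((π / 𝓛 ^ 9 + c / (8 * 𝓛)) * (Real.exp (π / 𝓛 ^ 9 * Ly) *
      (MU * (2 * (4 + 3 * 𝓛)) * (2 * (4 + 3 * 𝓛)) * (3 * Cinv * 𝓛 * 3)) / Real.exp 𝓛 ^ 2))) ≤
      3600 * Real.exp π * A₁ * Cinv * ((m + 57).factorial / 2 ^ (m + 57)) * (𝓛 ^ 4)⁻¹ := by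
  have h𝓛0 : 0 < 𝓛 := by linarith
  have hπ0 := Real.pi_pos
  have hL93 : (3 : ℝ) ^ 9 ≤ 𝓛 ^ 9 := pow_le_pow_left₀ (by norm_num) h𝓛 9
  have hαLy : π / 𝓛 ^ 9 * Ly ≤ π := by
    calc π / 𝓛 ^ 9 * Ly ≤ π / 𝓛 ^ 9 * 𝓛 ^ 9 := by gcongr
      _ = π := by field_simp
  have hexp1 : Real.exp (π / 𝓛 ^ 9 * Ly) ≤ Real.exp π := Real.exp_le_exp.2 hαLy
  have hαη1 : π / 𝓛 ^ 9 + c / (8 * 𝓛) ≤ 1 := by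
    have h1 : π / 𝓛 ^ 9 ≤ π / 3 ^ 9 := by gcongr
    have h2 : c / (8 * 𝓛) ≤ (1 / 4) / (8 * 3) := by gcongr
    nlinarith [Real.pi_le_four]
  have hBL : 2 * (4 + 3 * 𝓛) ≤ 10 * 𝓛 := by linarith
  have hBL0 : 0 ≤ 2 * (4 + 3 * 𝓛) := by positivity
  have h1 : Real.exp (π / 𝓛 ^ 9 * Ly) * (MU * (2 * (4 + 3 * 𝓛)) * (2 * (4 + 3 * 𝓛)) *
      (3 * Cinv * 𝓛 * 3)) ≤ Real.exp π * ((A₁ * 𝓛 ^ m) * (10 * 𝓛) * (10 * 𝓛) * (3 * Cinv * 𝓛 * 3)) := by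
    gcongr
  have hdec : 𝓛 ^ (m + 57) * Real.exp (-(2 * 𝓛)) ≤ ((m + 57).factorial : ℝ) / 2 ^ (m + 57) :=
    pow_mul_exp_neg_le (a := 2) (by norm_num) h𝓛0.le (m + 57)
  have hexp2𝓛 : Real.exp 𝓛 ^ 2 = Real.exp (2 * 𝓛) := by rw [← Real.exp_nat_mul]; norm_num
  have hT2 : 0 < Real.exp 𝓛 ^ 2 := pow_pos (Real.exp_pos 𝓛) 2
  have h3C : 0 ≤ 3 * Cinv * 𝓛 * 3 :=
    mul_nonneg (mul_nonneg (mul_nonneg (by norm_num) hCinv) h𝓛0.le) (by norm_num)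
  have hnum0 : 0 ≤ Real.exp (π / 𝓛 ^ 9 * Ly) * (MU * (2 * (4 + 3 * 𝓛)) * (2 * (4 + 3 * 𝓛)) *
      (3 * Cinv * 𝓛 * 3)) / Real.exp 𝓛 ^ 2 :=
    div_nonneg (mul_nonneg (Real.exp_pos _).le
      (mul_nonneg (mul_nonneg (mul_nonneg hMU0 hBL0) hBL0) h3C)) hT2.le
  have hXle : Real.exp (π / 𝓛 ^ 9 * Ly) * (MU * (2 * (4 + 3 * 𝓛)) * (2 * (4 + 3 * 𝓛)) *
      (3 * Cinv * 𝓛 * 3)) / Real.exp 𝓛 ^ 2 ≤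
      Real.exp π * ((A₁ * 𝓛 ^ m) * (10 * 𝓛) * (10 * 𝓛) * (3 * Cinv * 𝓛 * 3)) / Real.exp 𝓛 ^ 2 :=
    div_le_div_of_nonneg_right h1 hT2.le
  have hstep : (π / 𝓛 ^ 9 + c / (8 * 𝓛)) * (Real.exp (π / 𝓛 ^ 9 * Ly) *
      (MU * (2 * (4 + 3 * 𝓛)) * (2 * (4 + 3 * 𝓛)) * (3 * Cinv * 𝓛 * 3)) / Real.exp 𝓛 ^ 2) ≤
      Real.exp π * ((A₁ * 𝓛 ^ m) * (10 * 𝓛) * (10 * 𝓛) * (3 * Cinv * 𝓛 * 3)) / Real.exp 𝓛 ^ 2 := by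
    refine le_trans (mul_le_mul_of_nonneg_right hαη1 hnum0) ?_
    rw [one_mul]
    exact hXle
  have h450 : (0 : ℝ) ≤ 𝓛 ^ 50 * 4 := by positivity
  have hexp2inv : (Real.exp 𝓛 ^ 2)⁻¹ = Real.exp (-(2 * 𝓛)) := by rw [hexp2𝓛, Real.exp_neg]
  calc 𝓛 ^ 50 * (4 * ((π / 𝓛 ^ 9 + c / (8 * 𝓛)) * (Real.exp (π / 𝓛 ^ 9 * Ly) *
        (MU * (2 * (4 + 3 * 𝓛)) * (2 * (4 + 3 * 𝓛)) * (3 * Cinv * 𝓛 * 3)) / Real.exp 𝓛 ^ 2)))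
      = (𝓛 ^ 50 * 4) * ((π / 𝓛 ^ 9 + c / (8 * 𝓛)) * (Real.exp (π / 𝓛 ^ 9 * Ly) *
        (MU * (2 * (4 + 3 * 𝓛)) * (2 * (4 + 3 * 𝓛)) * (3 * Cinv * 𝓛 * 3)) / Real.exp 𝓛 ^ 2)) := by
        ring
    _ ≤ (𝓛 ^ 50 * 4) * (Real.exp π * ((A₁ * 𝓛 ^ m) * (10 * 𝓛) * (10 * 𝓛) * (3 * Cinv * 𝓛 * 3)) /
        Real.exp 𝓛 ^ 2) := mul_le_mul_of_nonneg_left hstep h450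
    _ = 3600 * Real.exp π * A₁ * Cinv * (𝓛 ^ m * 𝓛 ^ 57 * (Real.exp 𝓛 ^ 2)⁻¹) * (𝓛 ^ 4)⁻¹ := by
        field_simp; ring
    _ = 3600 * Real.exp π * A₁ * Cinv * (𝓛 ^ (m + 57) * Real.exp (-(2 * 𝓛))) * (𝓛 ^ 4)⁻¹ := by
        rw [hexp2inv, pow_add]
    _ ≤ 3600 * Real.exp π * A₁ * Cinv * (((m + 57).factorial : ℝ) / 2 ^ (m + 57)) * (𝓛 ^ 4)⁻¹ := by
        gcongr

set_option maxHeartbeats 800000 in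
/-- Piece 4 (small rectangle; the step `h` cancels): `672e^{αL/2}(Δ + M_mod) ≤ 672e^π(…)·𝓛⁻⁴Π̂⁴`.
[cite: Zhang2022LandauSiegel, §8 Lemma 8.4 (proof)] -/
private theorem piece4 (h𝓛 : 3 ≤ 𝓛) (hC : 0 ≤ C) (hK : 1 ≤ K) (hPi : 1 ≤ hatPi)
    (hLy0 : 0 ≤ Ly) (hLy2 : Ly ≤ 𝓛 ^ 9) :
    𝓛 ^ 50 * (672 * (𝓛 ^ 50)⁻¹ * Real.exp (π / 𝓛 ^ 9 * Ly / 2) *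
      (hatPi ^ 2 * ((1 + 16 * Real.exp (9 / 2) * π ^ 2 * K ^ 2) / 𝓛 ^ 15) * (24 * K ^ 2 + 2 * K) +
        32 * K ^ 3 * (C * (𝓛 ^ 8)⁻¹ * hatPi) * (2 * Real.exp (9 / 2) * (1 + 𝓛) * 𝓛) * (π / 𝓛 ^ 9) +
        (2 * Real.exp (9 / 2) * (1 + 𝓛) * 𝓛) * hatPi ^ 2 * (2 * K ^ 2 * (π / 𝓛 ^ 9)))) ≤
      672 * Real.exp π * ((1 + 16 * Real.exp (9 / 2) * π ^ 2 * K ^ 2) * (24 * K ^ 2 + 2 * K) +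
        128 * π * Real.exp (9 / 2) * K ^ 3 * C + 8 * π * Real.exp (9 / 2) * K ^ 2) *
        ((𝓛 ^ 4)⁻¹ * hatPi ^ 4) := by
  have h𝓛0 : 0 < 𝓛 := by linarith
  have h𝓛1 : 1 ≤ 𝓛 := by linarith
  have hπ0 := Real.pi_pos
  have hL93 : (3 : ℝ) ^ 9 ≤ 𝓛 ^ 9 := pow_le_pow_left₀ (by norm_num) h𝓛 9
  have hαLy : π / 𝓛 ^ 9 * Ly ≤ π := by
    calc π / 𝓛 ^ 9 * Ly ≤ π / 𝓛 ^ 9 * 𝓛 ^ 9 := by gcongr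
      _ = π := by field_simp
  have hαLy0 : 0 ≤ π / 𝓛 ^ 9 * Ly := by positivity
  have hexp2 : Real.exp (π / 𝓛 ^ 9 * Ly / 2) ≤ Real.exp π := Real.exp_le_exp.2 (by linarith)
  set W : ℝ := (𝓛 ^ 4)⁻¹ * hatPi ^ 4 with hW
  obtain ⟨C₅, hC₅⟩ : ∃ C₅ : ℝ, C₅ = 1 + 16 * Real.exp (9 / 2) * π ^ 2 * K ^ 2 := ⟨_, rfl⟩
  have hC₅0 : 0 ≤ C₅ := by rw [hC₅]; positivity
  rw [← hC₅]
  have hK0 : 0 ≤ K := le_trans zero_le_one hK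
  have h1L : (1 + 𝓛) * 𝓛 ≤ 2 * 𝓛 ^ 2 := by nlinarith
  have hL15 : (𝓛 ^ 15)⁻¹ ≤ (𝓛 ^ 4)⁻¹ :=
    inv_anti₀ (by positivity) (pow_le_pow_right₀ h𝓛1 (by norm_num))
  have hL7 : (𝓛 ^ 7)⁻¹ ≤ (𝓛 ^ 4)⁻¹ :=
    inv_anti₀ (by positivity) (pow_le_pow_right₀ h𝓛1 (by norm_num))
  have hPi2 : hatPi ^ 2 ≤ hatPi ^ 4 := pow_le_pow_right₀ hPi (by norm_num)
  have hPi1 : hatPi ≤ hatPi ^ 4 := le_self_pow₀ hPi (by norm_num)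
  have hPi0 : 0 ≤ hatPi := le_trans zero_le_one hPi
  have i1 : hatPi ^ 2 * (C₅ / 𝓛 ^ 15) * (24 * K ^ 2 + 2 * K) ≤ C₅ * (24 * K ^ 2 + 2 * K) * W := by
    calc hatPi ^ 2 * (C₅ / 𝓛 ^ 15) * (24 * K ^ 2 + 2 * K)
        = C₅ * (24 * K ^ 2 + 2 * K) * ((𝓛 ^ 15)⁻¹ * hatPi ^ 2) := by rw [div_eq_mul_inv]; ring
      _ ≤ C₅ * (24 * K ^ 2 + 2 * K) * ((𝓛 ^ 4)⁻¹ * hatPi ^ 4) := by gcongr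
      _ = C₅ * (24 * K ^ 2 + 2 * K) * W := by rw [hW]
  have i2 : 32 * K ^ 3 * (C * (𝓛 ^ 8)⁻¹ * hatPi) * (2 * Real.exp (9 / 2) * (1 + 𝓛) * 𝓛) *
      (π / 𝓛 ^ 9) ≤ 128 * π * Real.exp (9 / 2) * K ^ 3 * C * W := by
    calc 32 * K ^ 3 * (C * (𝓛 ^ 8)⁻¹ * hatPi) * (2 * Real.exp (9 / 2) * (1 + 𝓛) * 𝓛) * (π / 𝓛 ^ 9)
        = 64 * π * Real.exp (9 / 2) * K ^ 3 * C * (((1 + 𝓛) * 𝓛) * ((𝓛 ^ 8)⁻¹ / 𝓛 ^ 9 * hatPi)) := by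
          ring
      _ ≤ 64 * π * Real.exp (9 / 2) * K ^ 3 * C * ((2 * 𝓛 ^ 2) * ((𝓛 ^ 8)⁻¹ / 𝓛 ^ 9 * hatPi)) := by
          gcongr
      _ = 128 * π * Real.exp (9 / 2) * K ^ 3 * C * ((𝓛 ^ 15)⁻¹ * hatPi) := by
          field_simp; ring
      _ ≤ 128 * π * Real.exp (9 / 2) * K ^ 3 * C * ((𝓛 ^ 4)⁻¹ * hatPi ^ 4) := by gcongr
      _ = 128 * π * Real.exp (9 / 2) * K ^ 3 * C * W := by rw [hW]
  have i3 : (2 * Real.exp (9 / 2) * (1 + 𝓛) * 𝓛) * hatPi ^ 2 * (2 * K ^ 2 * (π / 𝓛 ^ 9)) ≤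
      8 * π * Real.exp (9 / 2) * K ^ 2 * W := by
    calc (2 * Real.exp (9 / 2) * (1 + 𝓛) * 𝓛) * hatPi ^ 2 * (2 * K ^ 2 * (π / 𝓛 ^ 9))
        = 4 * π * Real.exp (9 / 2) * K ^ 2 * (((1 + 𝓛) * 𝓛) * ((𝓛 ^ 9)⁻¹ * hatPi ^ 2)) := by
          rw [div_eq_mul_inv]; ring
      _ ≤ 4 * π * Real.exp (9 / 2) * K ^ 2 * ((2 * 𝓛 ^ 2) * ((𝓛 ^ 9)⁻¹ * hatPi ^ 2)) := by gcongr
      _ = 8 * π * Real.exp (9 / 2) * K ^ 2 * ((𝓛 ^ 7)⁻¹ * hatPi ^ 2) := by field_simp; ring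
      _ ≤ 8 * π * Real.exp (9 / 2) * K ^ 2 * ((𝓛 ^ 4)⁻¹ * hatPi ^ 4) := by gcongr
      _ = 8 * π * Real.exp (9 / 2) * K ^ 2 * W := by rw [hW]
  have hsum := add_le_add (add_le_add i1 i2) i3
  have hin0 : 0 ≤ hatPi ^ 2 * (C₅ / 𝓛 ^ 15) * (24 * K ^ 2 + 2 * K) +
      32 * K ^ 3 * (C * (𝓛 ^ 8)⁻¹ * hatPi) * (2 * Real.exp (9 / 2) * (1 + 𝓛) * 𝓛) * (π / 𝓛 ^ 9) +
      (2 * Real.exp (9 / 2) * (1 + 𝓛) * 𝓛) * hatPi ^ 2 * (2 * K ^ 2 * (π / 𝓛 ^ 9)) := by positivity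
  have hW0 : 0 ≤ W := by rw [hW]; positivity
  have e50 : 𝓛 ^ 50 * (672 * (𝓛 ^ 50)⁻¹ * Real.exp (π / 𝓛 ^ 9 * Ly / 2) *
      (hatPi ^ 2 * (C₅ / 𝓛 ^ 15) * (24 * K ^ 2 + 2 * K) +
        32 * K ^ 3 * (C * (𝓛 ^ 8)⁻¹ * hatPi) * (2 * Real.exp (9 / 2) * (1 + 𝓛) * 𝓛) * (π / 𝓛 ^ 9) +
        (2 * Real.exp (9 / 2) * (1 + 𝓛) * 𝓛) * hatPi ^ 2 * (2 * K ^ 2 * (π / 𝓛 ^ 9)))) =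
      672 * Real.exp (π / 𝓛 ^ 9 * Ly / 2) *
      (hatPi ^ 2 * (C₅ / 𝓛 ^ 15) * (24 * K ^ 2 + 2 * K) +
        32 * K ^ 3 * (C * (𝓛 ^ 8)⁻¹ * hatPi) * (2 * Real.exp (9 / 2) * (1 + 𝓛) * 𝓛) * (π / 𝓛 ^ 9) +
        (2 * Real.exp (9 / 2) * (1 + 𝓛) * 𝓛) * hatPi ^ 2 * (2 * K ^ 2 * (π / 𝓛 ^ 9))) := by
    have h50 : 𝓛 ^ 50 * (𝓛 ^ 50)⁻¹ = 1 := mul_inv_cancel₀ (by positivity)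
    calc _ = (𝓛 ^ 50 * (𝓛 ^ 50)⁻¹) * (672 * Real.exp (π / 𝓛 ^ 9 * Ly / 2) *
        (hatPi ^ 2 * (C₅ / 𝓛 ^ 15) * (24 * K ^ 2 + 2 * K) +
          32 * K ^ 3 * (C * (𝓛 ^ 8)⁻¹ * hatPi) * (2 * Real.exp (9 / 2) * (1 + 𝓛) * 𝓛) * (π / 𝓛 ^ 9) +
          (2 * Real.exp (9 / 2) * (1 + 𝓛) * 𝓛) * hatPi ^ 2 * (2 * K ^ 2 * (π / 𝓛 ^ 9)))) := by ring
      _ = _ := by rw [h50, one_mul]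
  rw [e50]
  calc 672 * Real.exp (π / 𝓛 ^ 9 * Ly / 2) *
        (hatPi ^ 2 * (C₅ / 𝓛 ^ 15) * (24 * K ^ 2 + 2 * K) +
          32 * K ^ 3 * (C * (𝓛 ^ 8)⁻¹ * hatPi) * (2 * Real.exp (9 / 2) * (1 + 𝓛) * 𝓛) * (π / 𝓛 ^ 9) +
          (2 * Real.exp (9 / 2) * (1 + 𝓛) * 𝓛) * hatPi ^ 2 * (2 * K ^ 2 * (π / 𝓛 ^ 9)))
      ≤ 672 * Real.exp π * (C₅ * (24 * K ^ 2 + 2 * K) * W + 128 * π * Real.exp (9 / 2) * K ^ 3 * C * W +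
          8 * π * Real.exp (9 / 2) * K ^ 2 * W) :=
        mul_le_mul (mul_le_mul_of_nonneg_left hexp2 (by norm_num)) hsum hin0 (by positivity)
    _ = _ := by ring

end Pieces

set_option maxHeartbeats 800000 in
/-- **Bookkeeping for the log-free core.** See the module docstring: the conclusion bounds the
right side of `Lemma84.logfree_core` divided by the step `h = 𝓛⁻⁵⁰` by an explicit constant times
`𝓛⁻⁴·Π̂⁴`. [cite: Zhang2022LandauSiegel, §12 (12.11) p.70; §8 Lemma 8.4 (proof)] -/
theorem rhs_logfree_le {𝓛 Ly Ly' h c Cinv C K A₁ hatPi MU α η T BL Minv : ℝ} {m : ℕ}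
    (h𝓛 : 3 ≤ 𝓛) (hc : 0 < c) (hc1 : c ≤ 1 / 4) (hCinv : 0 ≤ Cinv) (hC : 0 ≤ C) (hK : 1 ≤ K)
    (hA₁ : 0 ≤ A₁) (hMU0 : 0 ≤ MU) (hMU : MU ≤ A₁ * 𝓛 ^ m) (hPi : 1 ≤ hatPi)
    (hLy0 : 0 ≤ Ly) (hLy2 : Ly ≤ 𝓛 ^ 9) (hLy'1 : 0.004 * 𝓛 ^ 9 - 1 ≤ Ly')
    (hα : α = π / 𝓛 ^ 9) (hη : η = c / (8 * 𝓛)) (hT : T = Real.exp 𝓛) (hBL : BL = 2 * (4 + 3 * 𝓛))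
    (hMinv : Minv = 3 * Cinv * 𝓛) (hh : h = (𝓛 ^ 50)⁻¹) :
    (1 / (2 * π) * (4 * (Real.exp (α * Ly) * (MU * ((1 + α) / α) ^ 3) / T) +
        2 * (Real.exp (-η * Ly') * (MU * BL * BL * (Minv * (1 + 2 / η))) * (π / η)) +
        4 * ((α + η) * (Real.exp (α * Ly) * (MU * BL * BL * (Minv * 3)) / T ^ 2)) +
        672 * h * Real.exp (α * Ly / 2) *
          (hatPi ^ 2 * ((1 + 16 * Real.exp (9 / 2) * π ^ 2 * K ^ 2) / 𝓛 ^ 15) * (24 * K ^ 2 + 2 * K) +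
            32 * K ^ 3 * (C * (𝓛 ^ 8)⁻¹ * hatPi) * (2 * Real.exp (9 / 2) * (1 + 𝓛) * 𝓛) * α +
            (2 * Real.exp (9 / 2) * (1 + 𝓛) * 𝓛) * hatPi ^ 2 * (2 * K ^ 2 * α)))) / h ≤
      (1 / (2 * π) * (4 * Real.exp π * A₁ * (m + 81).factorial +
          81600 * π * Real.exp (1 / 96) * A₁ * Cinv / c ^ 2 *
            ((m + 59).factorial / (c / 2000) ^ (m + 59)) +
          3600 * Real.exp π * A₁ * Cinv * ((m + 57).factorial / 2 ^ (m + 57)) +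
          672 * Real.exp π * ((1 + 16 * Real.exp (9 / 2) * π ^ 2 * K ^ 2) * (24 * K ^ 2 + 2 * K) +
            128 * π * Real.exp (9 / 2) * K ^ 3 * C + 8 * π * Real.exp (9 / 2) * K ^ 2))) *
        (𝓛 ^ 4)⁻¹ * hatPi ^ 4 := by
  subst hα hη hT hBL hMinv hh
  have h𝓛0 : 0 < 𝓛 := by linarith
  have hπ0 := Real.pi_pos
  set W : ℝ := (𝓛 ^ 4)⁻¹ * hatPi ^ 4 with hW
  have hPi4 : 1 ≤ hatPi ^ 4 := one_le_pow₀ hPi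
  have hW4 : (𝓛 ^ 4)⁻¹ ≤ W := by
    rw [hW]; exact le_mul_of_one_le_right (by positivity) hPi4
  have t1 := (piece1 (m := m) h𝓛 hA₁ hMU0 hMU hLy2).trans
    (mul_le_mul_of_nonneg_left hW4 (by positivity))
  have t2 := (piece2 (m := m) h𝓛 hc hc1 hCinv hA₁ hMU hLy'1).trans
    (mul_le_mul_of_nonneg_left hW4 (by positivity))
  have t3 := (piece3 (m := m) h𝓛 hc hc1 hCinv hA₁ hMU0 hMU hLy2).trans
    (mul_le_mul_of_nonneg_left hW4 (by positivity))
  have t4 := piece4 (C := C) h𝓛 hC hK hPi hLy0 hLy2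
  rw [← hW] at t4
  have hdiv : ∀ X : ℝ, X / (𝓛 ^ 50)⁻¹ = 𝓛 ^ 50 * X := fun X => by
    rw [div_eq_mul_inv, inv_inv, mul_comm]
  rw [hdiv]
  have hsum := add_le_add (add_le_add (add_le_add t1 t2) t3) t4
  have hπ2 : 0 ≤ 1 / (2 * π) := by positivity
  calc 𝓛 ^ 50 * (1 / (2 * π) * (4 * (Real.exp (π / 𝓛 ^ 9 * Ly) *
          (MU * ((1 + π / 𝓛 ^ 9) / (π / 𝓛 ^ 9)) ^ 3) / Real.exp 𝓛) +
        2 * (Real.exp (-(c / (8 * 𝓛)) * Ly') *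
          (MU * (2 * (4 + 3 * 𝓛)) * (2 * (4 + 3 * 𝓛)) * (3 * Cinv * 𝓛 * (1 + 2 / (c / (8 * 𝓛))))) *
            (π / (c / (8 * 𝓛)))) +
        4 * ((π / 𝓛 ^ 9 + c / (8 * 𝓛)) * (Real.exp (π / 𝓛 ^ 9 * Ly) *
          (MU * (2 * (4 + 3 * 𝓛)) * (2 * (4 + 3 * 𝓛)) * (3 * Cinv * 𝓛 * 3)) / Real.exp 𝓛 ^ 2)) +
        672 * (𝓛 ^ 50)⁻¹ * Real.exp (π / 𝓛 ^ 9 * Ly / 2) *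
          (hatPi ^ 2 * ((1 + 16 * Real.exp (9 / 2) * π ^ 2 * K ^ 2) / 𝓛 ^ 15) * (24 * K ^ 2 + 2 * K) +
            32 * K ^ 3 * (C * (𝓛 ^ 8)⁻¹ * hatPi) * (2 * Real.exp (9 / 2) * (1 + 𝓛) * 𝓛) * (π / 𝓛 ^ 9) +
            (2 * Real.exp (9 / 2) * (1 + 𝓛) * 𝓛) * hatPi ^ 2 * (2 * K ^ 2 * (π / 𝓛 ^ 9)))))
      = 1 / (2 * π) * (𝓛 ^ 50 * (4 * (Real.exp (π / 𝓛 ^ 9 * Ly) *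
          (MU * ((1 + π / 𝓛 ^ 9) / (π / 𝓛 ^ 9)) ^ 3) / Real.exp 𝓛)) +
        𝓛 ^ 50 * (2 * (Real.exp (-(c / (8 * 𝓛)) * Ly') *
          (MU * (2 * (4 + 3 * 𝓛)) * (2 * (4 + 3 * 𝓛)) * (3 * Cinv * 𝓛 * (1 + 2 / (c / (8 * 𝓛))))) *
            (π / (c / (8 * 𝓛))))) +
        𝓛 ^ 50 * (4 * ((π / 𝓛 ^ 9 + c / (8 * 𝓛)) * (Real.exp (π / 𝓛 ^ 9 * Ly) *
          (MU * (2 * (4 + 3 * 𝓛)) * (2 * (4 + 3 * 𝓛)) * (3 * Cinv * 𝓛 * 3)) / Real.exp 𝓛 ^ 2))) +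
        𝓛 ^ 50 * (672 * (𝓛 ^ 50)⁻¹ * Real.exp (π / 𝓛 ^ 9 * Ly / 2) *
          (hatPi ^ 2 * ((1 + 16 * Real.exp (9 / 2) * π ^ 2 * K ^ 2) / 𝓛 ^ 15) * (24 * K ^ 2 + 2 * K) +
            32 * K ^ 3 * (C * (𝓛 ^ 8)⁻¹ * hatPi) * (2 * Real.exp (9 / 2) * (1 + 𝓛) * 𝓛) * (π / 𝓛 ^ 9) +
            (2 * Real.exp (9 / 2) * (1 + 𝓛) * 𝓛) * hatPi ^ 2 * (2 * K ^ 2 * (π / 𝓛 ^ 9))))) := by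
        ring
    _ ≤ 1 / (2 * π) * (4 * Real.exp π * A₁ * (m + 81).factorial * W +
          81600 * π * Real.exp (1 / 96) * A₁ * Cinv / c ^ 2 *
            ((m + 59).factorial / (c / 2000) ^ (m + 59)) * W +
          3600 * Real.exp π * A₁ * Cinv * ((m + 57).factorial / 2 ^ (m + 57)) * W +
          672 * Real.exp π * ((1 + 16 * Real.exp (9 / 2) * π ^ 2 * K ^ 2) * (24 * K ^ 2 + 2 * K) +
            128 * π * Real.exp (9 / 2) * K ^ 3 * C + 8 * π * Real.exp (9 / 2) * K ^ 2) * W) :=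
        mul_le_mul_of_nonneg_left hsum hπ2
    _ = _ := by rw [hW]; ring

end Literature.NumberTheory.LFunctions.Zhang2022.Lemma84
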